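import Mathlib
import Literature.MathematicalPhysics.QuantumFieldTheory.Balaban1983to89.Beta.InfiniteVolume

/-!
# `Balaban1983to89.Beta.InfiniteVolumeRate` — the limit `T ↗ ℤ^d` of (1.21)–(1.22) of [Balaban1987RG1] WITH A RATE:
# an explicit finite-volume error for the torus second moment, and the (AF-0s) list from certified torus values

T. Bałaban, *Renormalization group approach to lattice gauge field theories. I. Generation of effective actions in a
small field approximation and a coupling constant renormalization in four dimensions*, Commun. Math. Phys. **109**,
249–301 (1987) [Balaban1987RG1] (cell paper B12; PDF page = journal page − 248; PDF held:
`paper:balaban1987-cmp109-rg-i-small-field`).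

CITATION HEADER (lean-in-tree rule 2026-08-18).  KERNEL-CHECKED BOOKKEEPING about lattice sums for the β sub-cell of
the Bałaban YM₄ reconstruction (audit cell `pub-balaban`; unit `b2b-balaban-pv04` gen 3, journal node
`BETA-G4-VOLLIM-KERNEL`; cell records `HOME/GAPS.md` G-beta-4, `HOME/BETA/OBJECTS.md` §5(d)).  It is the QUANTITATIVE
SIBLING of `…Beta.InfiniteVolume` (unit `b2b-balaban-pv01` gen 3), whose docstring reserves exactly this: *"A QUANTITATIVE
version (an explicit finite-volume error from an explicit convergence RATE, which is what certifying (AF-0s) from ONE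
finite torus requires) is deliberately NOT here"*.  This module imports that one and re-proves nothing of it: the window
bookkeeping (`InWindow`, `windowMap`, `siteOf`, `windowExt`, `windowKernel`,
`torusSecondMoment_eq_secondMoment_windowKernel`), the volume-uniform decay hypothesis `UniformDecay` and the dominated
convergence theorem `tendsto_torusSecondMoment` are USED BY NAME.

THE PRINTED TEXT THIS MODULE IS ABOUT (verbatim, from the 300-dpi renders `1987-cmp109-rg-I-small-field-pNNN-x2.png`,
NNN ∈ {016, 045}, under `HOME/b2b-balaban-ref1/pages/1987-cmp109-rg-I-small-field/`):
* p. 264 [PDF 16], after **(1.21)**: *"Now we take a limit of these functions as T^{(j+1)} ↗ Z^d. This limit exists by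
  the localized representation (1.7)."* and **(1.22)**: *"The function β_{j+1}(g_j) is defined by … =
  Σ_x Π_{j+1,μν}(g_j, x) x_μ x_ν (1.22) for μ, ν arbitrary, μ ≠ ν"* (typed: `B12Beta.secondMoment`).
* p. 293 [PDF 45], **(5.10)**: *"The representation (4.37) yields the following inequality |Π_{μν}(x − y)| ≦ O(1)E₀
  exp(−δ₁|x − y|), (5.10) with a positive constant δ₁ determined by δ₀, κ, and M (e.g., δ₁ = 1/2min{δ₀, κM⁻¹})."*
  (typed: `B12Sec2to5.Decay510`), and, same page: *"This property is the basic reason why we have taken the infinite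
  volume limit in (5.1)."*
Print states the EXISTENCE of the limit (1.21) in one sentence and the decay (5.10) for the limit kernel; it states NO
RATE of convergence in the volume.  A rate is what turns ONE finite-torus computation of the one-loop coefficient (row
num's observable `Beta.torusBetaZero`) into a certified inequality about the (1.22) coefficient `S.β0 k` — the (AF-0s)
entries `∀ k < k₀, 3β⁰_∞/4 ≤ S.β0 k` of `FlowStepRuns.thm2Printed_of_limitSplit` / `betaLowerH_of_limitSplit`.

WHAT IS PROVED HERE (every `theorem` kernel-checked; elementary analysis, no physics):
* Part 1 — complements on the window: `Beta.symmRep s = ZMod.valMinAbs` (the Mathlib name of pv25's symmetric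
  representative, so that Mathlib's `valMinAbs` lemmas apply to `windowMap`); outside the window cube of side `s` one has
  `|y|₁ ≥ s/2`, whence the TAIL SPLITTING `e^{−δ|y|₁} ≤ e^{−δs/4}·e^{−(δ/2)|y|₁}` (δ ≥ 0).
* Part 2 — the typed hypothesis `VolumeRate side P Pinf ρ δ` (on the window of the torus of side `side t` the torus
  kernel differs from the limit kernel by `≤ ρ t·e^{−δ|x|₁}`) and what it entails for the hypotheses of the sibling module:
  `ρ t → 0` and `side t → ∞` ⇒ pv25's `IsInfiniteVolumeLimit` ((1.21) as typed) — `VolumeRate.isInfiniteVolumeLimit`;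
  (5.10) for the limit kernel with `(C, δ)` and `ρ ≤ R` ⇒ `UniformDecay side P (C + R) δ` —
  `VolumeRate.uniformDecay`.  So print's (5.10) (stated for the LIMIT kernel) plus a rate deliver both inputs of
  `InfiniteVolume.tendsto_torusSecondMoment`.
* Part 3 — THE EXPLICIT VOLUME ERROR: (5.10) for `Pinf` with `(C, δ)`, `δ > 0`, and `VolumeRate side P Pinf ρ δ` ⇒ for
  EVERY volume index `t` and every pair `(μ, ν)`
  `|torusSecondMoment (P t) μ ν − B12Beta.secondMoment Pinf μ ν| ≤ β′(ρ t, δ) + e^{−δ·side t/4}·β′(C, δ/2)`,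
  `β′ = B12Sec2to5.betaPrime510` (b03's §5 constant `C·Σ_{x∈ℤ^d}|x|₁²e^{−δ|x|₁}`): first term = the defect on the
  window, second = the tail of (1.22) outside the window (`abs_torusSecondMoment_sub_secondMoment_le`, via the two-rate
  dominated summation `abs_weightedTsum_le_of_twoRate`).  The right member tends to `0` when `ρ t → 0`, `side t → ∞`
  (`tendsto_volumeError`) — consistency with the qualitative theorem of the sibling module.
* Part 4 — read on pv25's hypothesis carrier `OneLoopDictionary` (fields `isLimit` = (1.21), `beta0_eq` = (1.22) for the
  one-loop part): `|torusBetaZero (D.model k t) a μ ν − S.β0 k| ≤ ε k t` with the explicit `ε` (`μ ≠ ν`)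
  (`OneLoopDictionary.abs_torusBetaZero_sub_beta0_le`, and the primed form taking `UniformDecay` of the torus kernels
  instead of (5.10) for the limit kernel), and the (AF-0s) bookkeeping: an error bound plus, for each `k < k₀`, ONE
  volume at which a certified computation gives `3β⁰_∞/4 + ε k t ≤ β⁰_T` yield `∀ k < k₀, 3β⁰_∞/4 ≤ S.β0 k`
  (`OneLoopDictionary.beta0_lower_of_certifiedTori`, assembled end-to-end in
  `OneLoopDictionary.hsmall_of_volumeRate`).

HONEST FRAMING.  Nothing in this file asserts anything about Bałaban's kernels.  `VolumeRate` (like `UniformDecay` of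
the sibling module) is a LOCATED UNPRINTED INPUT of GAPS G-beta-4, carried as a hypothesis (`def … : Prop`, used only to
the left of `→`), never a fact; for Bałaban's kernels one expects `ρ t = O(1)e^{−δ′·side t}` from the localized /
random-walk representations of [Balaban1985BackgroundPropagators] with volume-independent constants — NOT printed, NOT
claimed.  The certified torus inequalities of Part 4 are row num's to supply.  The β sub-cell as a whole would, if
completed, make the cell's UV-stability bookkeeping unconditional in its flow input (`BetaPertH`) — a constructive-QFT
statement that is NOT the continuum limit, NOT a mass gap, NOT the Clay problem.  Value = kernel bookkeeping for a
located gap, NOT summit progress.  Distinct from the SCALE limit `k → ∞` of `S.β0 k` (`…Beta.LimitRate`, row an5): here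
the scale is fixed and only the volume grows.

DIVERGENCE (cell record D-pv04.4).  As in the sibling module (D-pv01.7): the lattice distance of (5.10) is unspecified
in print and `B12Sec2to5.l1` (ℓ¹ of the window coordinates) is used; the window `]−s/2, s/2]` is pv25's `symmRep`
(= `ZMod.valMinAbs`); the constants `4` and `δ/2` of the tail splitting are a convenient choice, not optimal and not
printed.
-/

namespace Literature.MathematicalPhysics.QuantumFieldTheory.Balaban1983to89.Beta

open Literature.MathematicalPhysics.QuantumFieldTheory.Balaban1983to89
open Literature.MathematicalPhysics.QuantumFieldTheory.Balaban1983to89.B12Sec2to5 (l1 l1_nonneg abs_coord_le_l1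
  Decay510 majorant_summable betaPrime510)
open _root_.Filter
open scoped _root_.Topology

/-! ## Part 1 — complements on the window `]−s/2, s/2]`: the Mathlib name of `symmRep`, and the tail splitting -/

/-- `Beta.symmRep` IS Mathlib's minimal-absolute-value representative `ZMod.valMinAbs` (the integer of the class in
`]−s/2, s/2]`). [folklore] -/
theorem symmRep_eq_valMinAbs (s : ℕ) [NeZero s] (z : ZMod s) : symmRep s z = z.valMinAbs := by
  rw [symmRep, ZMod.valMinAbs_def_pos]
  by_cases h : 2 * z.val ≤ s
  · rw [if_pos h, if_pos (by omega)]
  · rw [if_neg h, if_neg (by omega)]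

/-- The window coordinates of a torus site are the `valMinAbs` of its residues. [folklore] -/
theorem windowMap_apply_eq_valMinAbs (d s : ℕ) [NeZero s] (x : Site d s) (i : Fin d) :
    windowMap d s x i = (x i).valMinAbs :=
  symmRep_eq_valMinAbs s (x i)

/-- Off the window in one coordinate: `¬ InWindow s z ⇒ s ≤ 2|z|`. [folklore] -/
theorem le_two_mul_abs_of_not_inWindow {s : ℕ} {z : ℤ} (h : ¬ InWindow s z) : (s : ℤ) ≤ 2 * |z| := by
  by_contra h'
  exact h (inWindow_of_two_mul_abs_lt (lt_of_not_ge h'))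

/-- Off the window cube of side `s`, `|y|₁ ≥ s/2`. [folklore] -/
theorem half_side_le_l1_of_not_window {d s : ℕ} {y : Fin d → ℤ} (h : ¬ ∀ i, InWindow s (y i)) :
    (s : ℝ) / 2 ≤ l1 y := by
  obtain ⟨i, hi⟩ : ∃ i, ¬ InWindow s (y i) := not_forall.mp h
  have h1 : (s : ℤ) ≤ 2 * |y i| := le_two_mul_abs_of_not_inWindow hi
  have h2 : (s : ℝ) ≤ 2 * |(y i : ℝ)| := by
    rw [← Int.cast_abs]
    exact_mod_cast h1
  have h3 := abs_coord_le_l1 y i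
  linarith

/-- TAIL SPLITTING: off the window cube of side `s`, `e^{−δ|y|₁} ≤ e^{−δs/4}·e^{−(δ/2)|y|₁}` (δ ≥ 0). [folklore] -/
theorem exp_decay_tail_of_not_window {d s : ℕ} {δ : ℝ} (hδ : 0 ≤ δ) {y : Fin d → ℤ}
    (hy : ¬ ∀ i, InWindow s (y i)) :
    Real.exp (-δ * l1 y) ≤ Real.exp (-δ * s / 4) * Real.exp (-(δ / 2) * l1 y) := by
  rw [← Real.exp_add]
  apply Real.exp_le_exp.mpr
  have h1 := half_side_le_l1_of_not_window hy
  nlinarith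

/-- From `|a| ≤ C·e^r` the constant is `≥ 0`. [folklore] -/
theorem nonneg_of_abs_le_mul_exp {a C r : ℝ} (h : |a| ≤ C * Real.exp r) : 0 ≤ C := by
  by_contra hC
  have : C * Real.exp r < 0 := mul_neg_of_neg_of_pos (lt_of_not_ge hC) (Real.exp_pos r)
  linarith [abs_nonneg a]

/-- Under (5.10) for a kernel on `ℤ^d` the constant is `≥ 0` (read the bound at the origin). [folklore] -/
theorem decay510_constant_nonneg {d : ℕ} {K : (Fin d → ℤ) → ℝ} {C δ : ℝ} (h : Decay510 K C δ) : 0 ≤ C :=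
  nonneg_of_abs_le_mul_exp (h fun _ => 0)

/-! ## Part 2 — the typed hypothesis `VolumeRate` and what it entails for (1.21) and for `UniformDecay` -/

/-- **TYPED HYPOTHESIS (located unprinted input, GAPS G-beta-4 — NOT a fact): a VOLUME RATE.**  On the window of the
torus of side `side t` (window coordinates `windowMap`), the torus kernel `P t` differs from the limit kernel `Pinf` by at
most `ρ t · e^{−δ|x|₁}`.  Print asserts the existence of the limit (1.21) p. 264 and no rate; for Bałaban's kernels a
rate `ρ t = O(1)e^{−δ′ side t}` is expected from the localized representation "(1.7)" invoked there, and is NOT printed.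
A `Prop`, used only to the left of `→`. [cite: Balaban1987RG1, (1.21) p.264] -/
def VolumeRate {d : ℕ} (side : ℕ → ℕ) [∀ t, NeZero (side t)]
    (P : (t : ℕ) → Fin d → Fin d → Site d (side t) → ℝ) (Pinf : B12Beta.Kernel d) (ρ : ℕ → ℝ) (δ : ℝ) : Prop :=
  ∀ (t : ℕ) (μ ν : Fin d) (x : Site d (side t)),
    |P t μ ν x - Pinf μ ν (windowMap d (side t) x)| ≤ ρ t * Real.exp (-δ * l1 (windowMap d (side t) x))

section Rate

variable {d : ℕ} {side : ℕ → ℕ} [∀ t, NeZero (side t)]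
  {P : (t : ℕ) → Fin d → Fin d → Site d (side t) → ℝ} {Pinf : B12Beta.Kernel d} {C δ : ℝ} {ρ : ℕ → ℝ}

/-- Under `VolumeRate` the moduli are `≥ 0` (read the bound at the origin of the torus). [folklore] -/
theorem VolumeRate.nonneg (h : VolumeRate side P Pinf ρ δ) (t : ℕ) (μ ν : Fin d) : 0 ≤ ρ t :=
  nonneg_of_abs_le_mul_exp (h t μ ν fun _ => 0)

/-- `VolumeRate` read through the window kernel: on the window, `|windowKernel (P t) μ ν y − Pinf μ ν y| ≤
ρ t·e^{−δ|y|₁}`. [folklore] -/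
theorem VolumeRate.window (h : VolumeRate side P Pinf ρ δ) (t : ℕ) (μ ν : Fin d) {y : Fin d → ℤ}
    (hy : ∀ i, InWindow (side t) (y i)) :
    |windowKernel (P t) μ ν y - Pinf μ ν y| ≤ ρ t * Real.exp (-δ * l1 y) := by
  have h1 := h t μ ν (siteOf d (side t) y)
  rw [windowMap_siteOf d (side t) hy] at h1
  show |windowExt (P t μ ν) y - Pinf μ ν y| ≤ _
  rwa [windowExt_of_inWindow _ hy]

/-- **RATE ⇒ (1.21).**  A volume rate with `ρ t → 0` along sides `side t → ∞` gives pv25's pointwise limit predicate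
`IsInfiniteVolumeLimit side P Pinf` (every fixed `y ∈ ℤ^d` is eventually inside the window, where the rate bound
applies).  So a rate hypothesis SUBSUMES the dictionary field `isLimit`. [cite: Balaban1987RG1, (1.21) p.264] -/
theorem VolumeRate.isInfiniteVolumeLimit (h : VolumeRate side P Pinf ρ δ) (hρ : Tendsto ρ atTop (𝓝 0))
    (hside : Tendsto side atTop atTop) : IsInfiniteVolumeLimit side P Pinf := by
  intro μ ν y
  apply tendsto_sub_nhds_zero_iff.mp
  have hmaj : Tendsto (fun t => ρ t * Real.exp (-δ * l1 y)) atTop (𝓝 0) := by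
    simpa using hρ.mul_const (Real.exp (-δ * l1 y))
  refine squeeze_zero_norm' ?_ hmaj
  filter_upwards [eventually_inWindow hside y] with t ht
  rw [Real.norm_eq_abs]
  have h1 := h t μ ν (siteOf d (side t) y)
  rw [windowMap_siteOf d (side t) ht] at h1
  exact h1

/-- **RATE + (5.10) FOR THE LIMIT ⇒ VOLUME-UNIFORM DECAY.**  If the limit kernel obeys (5.10) with `(C, δ)` and the
torus kernels approach it at a bounded rate `ρ t ≤ R` (same `δ`), then the torus kernels obey the sibling module's
`UniformDecay` with constant `C + R` — i.e. print's (5.10), stated for the LIMIT kernel (p. 293), plus a rate give the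
hypothesis of `InfiniteVolume.tendsto_torusSecondMoment`. [cite: Balaban1987RG1, (5.10) p.293] -/
theorem VolumeRate.uniformDecay (h : VolumeRate side P Pinf ρ δ) (hinf : ∀ μ ν, Decay510 (Pinf μ ν) C δ) {R : ℝ}
    (hR : ∀ t, ρ t ≤ R) : UniformDecay side P (C + R) δ := by
  intro t μ ν x
  have h1 := h t μ ν x
  have h2 := hinf μ ν (windowMap d (side t) x)
  have h3 := abs_sub_abs_le_abs_sub (P t μ ν x) (Pinf μ ν (windowMap d (side t) x))
  have h4 : ρ t * Real.exp (-δ * l1 (windowMap d (side t) x)) ≤ R * Real.exp (-δ * l1 (windowMap d (side t) x)) :=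
    mul_le_mul_of_nonneg_right (hR t) (Real.exp_pos _).le
  linarith

/-- The qualitative theorem of the sibling module under the hypotheses of this one: (5.10) for the limit kernel
(`δ > 0`) and a bounded rate tending to `0` along growing sides give `torusSecondMoment (P t) μ ν →
B12Beta.secondMoment Pinf μ ν`. [cite: Balaban1987RG1, (1.22) p.264] -/
theorem VolumeRate.tendsto_torusSecondMoment (h : VolumeRate side P Pinf ρ δ) (hδ : 0 < δ)
    (hinf : ∀ μ ν, Decay510 (Pinf μ ν) C δ) {R : ℝ} (hR : ∀ t, ρ t ≤ R) (hρ : Tendsto ρ atTop (𝓝 0))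
    (hside : Tendsto side atTop atTop) (μ ν : Fin d) :
    Tendsto (fun t => torusSecondMoment (P t) μ ν) atTop (𝓝 (B12Beta.secondMoment Pinf μ ν)) :=
  Beta.tendsto_torusSecondMoment hside (h.isInfiniteVolumeLimit hρ hside) hδ (h.uniformDecay hinf hR) μ ν

end Rate

/-! ## Part 3 — THE EXPLICIT VOLUME ERROR for the second moment -/

/-- Two-rate dominated summation: `|K(y)| ≤ A e^{−a|y|₁} + B e^{−b|y|₁}` (a, b > 0) ⇒ the (1.22)-shaped sum of `K`
converges absolutely and `|Σ'_y K(y) y_μ y_ν| ≤ A·M(a) + B·M(b)`, `M(c) = Σ'_y |y|₁² e^{−c|y|₁}` (b03's majorant).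
[folklore] -/
theorem abs_weightedTsum_le_of_twoRate {d : ℕ} {K : (Fin d → ℤ) → ℝ} {A a B b : ℝ} (ha : 0 < a) (hb : 0 < b)
    (h : ∀ y, |K y| ≤ A * Real.exp (-a * l1 y) + B * Real.exp (-b * l1 y)) (μ ν : Fin d) :
    Summable (fun y : Fin d → ℤ => K y * (y μ : ℝ) * (y ν : ℝ)) ∧
      |∑' y : Fin d → ℤ, K y * (y μ : ℝ) * (y ν : ℝ)| ≤
        A * (∑' y : Fin d → ℤ, l1 y ^ 2 * Real.exp (-a * l1 y)) +
          B * (∑' y : Fin d → ℤ, l1 y ^ 2 * Real.exp (-b * l1 y)) := by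
  have hHS := ((majorant_summable ha d).hasSum.mul_left A).add ((majorant_summable hb d).hasSum.mul_left B)
  have hpt : ∀ y : Fin d → ℤ, ‖K y * (y μ : ℝ) * (y ν : ℝ)‖ ≤
      A * (l1 y ^ 2 * Real.exp (-a * l1 y)) + B * (l1 y ^ 2 * Real.exp (-b * l1 y)) := by
    intro y
    rw [Real.norm_eq_abs, abs_mul, abs_mul]
    have h1 := h y
    have h2 := abs_coord_le_l1 y μ
    have h3 := abs_coord_le_l1 y ν
    have h0 : 0 ≤ A * Real.exp (-a * l1 y) + B * Real.exp (-b * l1 y) := (abs_nonneg _).trans h1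
    calc |K y| * |(y μ : ℝ)| * |(y ν : ℝ)|
        ≤ (A * Real.exp (-a * l1 y) + B * Real.exp (-b * l1 y)) * l1 y * l1 y :=
          mul_le_mul (mul_le_mul h1 h2 (abs_nonneg _) h0) h3 (abs_nonneg _) (mul_nonneg h0 (l1_nonneg y))
      _ = A * (l1 y ^ 2 * Real.exp (-a * l1 y)) + B * (l1 y ^ 2 * Real.exp (-b * l1 y)) := by ring
  refine ⟨Summable.of_norm_bounded hHS.summable hpt, ?_⟩
  have := tsum_of_norm_bounded hHS hpt
  rwa [Real.norm_eq_abs] at this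

section Error

variable {d : ℕ} {side : ℕ → ℕ} [∀ t, NeZero (side t)]
  {P : (t : ℕ) → Fin d → Fin d → Site d (side t) → ℝ} {Pinf : B12Beta.Kernel d} {C δ : ℝ} {ρ : ℕ → ℝ}

/-- **THE EXPLICIT VOLUME ERROR (quantitative form of G-beta-4).**  If the limit kernel obeys (5.10) with `(C, δ)`,
`δ > 0`, and the torus kernels approach it at the volume rate `ρ` on the windows (`VolumeRate`), then for EVERY volume
index `t`: `|Σ_{x∈T_t} P^t_{μν}(x)x̂_μx̂_ν − Σ_{x∈ℤ^d} Π_{μν}(x)x_μx_ν| ≤ β′(ρ t, δ) + e^{−δ·side t/4}·β′(C, δ/2)`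
(`β′ = B12Sec2to5.betaPrime510`; first term = the defect on the window, second = the tail of (1.22) off the window, where
`|x|₁ ≥ side t/2`).  For a fixed volume the right member is a NUMBER — the error bar a certified torus computation of β⁰
must beat (row num).  Proof: both (1.22)-sums converge absolutely ((5.10) for `windowKernel (P t)` with constant `C + ρ t`
and for `Pinf`), their difference is the sum of the difference kernel, which obeys the two-rate bound of
`abs_weightedTsum_le_of_twoRate`. [cite: Balaban1987RG1, (1.22) p.264] -/
theorem abs_torusSecondMoment_sub_secondMoment_le (hδ : 0 < δ) (hinf : ∀ μ ν, Decay510 (Pinf μ ν) C δ)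
    (hrate : VolumeRate side P Pinf ρ δ) (t : ℕ) (μ ν : Fin d) :
    |torusSecondMoment (P t) μ ν - B12Beta.secondMoment Pinf μ ν| ≤
      betaPrime510 d (ρ t) δ + Real.exp (-δ * side t / 4) * betaPrime510 d C (δ / 2) := by
  have hC : 0 ≤ C := decay510_constant_nonneg (hinf μ ν)
  have hρ : 0 ≤ ρ t := hrate.nonneg t μ ν
  -- the difference kernel and its two-rate bound
  set K : (Fin d → ℤ) → ℝ := fun y => windowKernel (P t) μ ν y - Pinf μ ν y with hK
  have hKb : ∀ y, |K y| ≤ ρ t * Real.exp (-δ * l1 y) +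
      (C * Real.exp (-δ * side t / 4)) * Real.exp (-(δ / 2) * l1 y) := by
    intro y
    by_cases hy : ∀ i, InWindow (side t) (y i)
    · have h1 := hrate.window t μ ν hy
      have h2 : 0 ≤ (C * Real.exp (-δ * side t / 4)) * Real.exp (-(δ / 2) * l1 y) := by positivity
      simp only [hK]
      linarith
    · have h1 := hinf μ ν y
      have h2 : 0 ≤ ρ t * Real.exp (-δ * l1 y) := by positivity
      have h3 := mul_le_mul_of_nonneg_left (exp_decay_tail_of_not_window (d := d) hδ.le hy) hC
      have h4 : windowKernel (P t) μ ν y = 0 := windowExt_of_not_inWindow (P t μ ν) hy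
      simp only [hK, h4, zero_sub, abs_neg]
      linarith
  -- (5.10) for the window kernel with constant `C + ρ t`, hence absolute convergence of both (1.22)-sums
  have hdecW : Decay510 (windowKernel (P t) μ ν) (C + ρ t) δ := by
    intro y
    by_cases hy : ∀ i, InWindow (side t) (y i)
    · have h1 := hrate.window t μ ν hy
      have h2 := hinf μ ν y
      have h3 := abs_sub_abs_le_abs_sub (windowKernel (P t) μ ν y) (Pinf μ ν y)
      have : |windowKernel (P t) μ ν y| ≤ (C + ρ t) * Real.exp (-δ * l1 y) := by linarith
      exact this
    · have h4 : windowKernel (P t) μ ν y = 0 := windowExt_of_not_inWindow (P t μ ν) hy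
      rw [h4, abs_zero]
      positivity
  have hsumW := (B12Sec2to5.secondMoment_abs_le_of_decay510 (P := windowKernel (P t)) hδ hdecW).1
  have hsumI := (B12Sec2to5.secondMoment_abs_le_of_decay510 hδ (hinf μ ν)).1
  have hdiff : torusSecondMoment (P t) μ ν - B12Beta.secondMoment Pinf μ ν =
      ∑' y : Fin d → ℤ, K y * (y μ : ℝ) * (y ν : ℝ) := by
    rw [torusSecondMoment_eq_secondMoment_windowKernel, B12Beta.secondMoment, B12Beta.secondMoment,
      ← hsumW.tsum_sub hsumI]
    refine tsum_congr fun y => ?_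
    simp only [hK]
    ring
  rw [hdiff]
  have hmain := (abs_weightedTsum_le_of_twoRate hδ (half_pos hδ) hKb μ ν).2
  refine hmain.trans (le_of_eq ?_)
  simp only [betaPrime510]
  ring

omit [∀ t, NeZero (side t)] in
/-- The explicit error tends to `0` when `ρ t → 0` and `side t → ∞` (δ > 0) — so Part 3 recovers the qualitative limit
of the sibling module, with a rate. [folklore] -/
theorem tendsto_volumeError (hδ : 0 < δ) (hρ : Tendsto ρ atTop (𝓝 0)) (hside : Tendsto side atTop atTop) (C : ℝ) :
    Tendsto (fun t => betaPrime510 d (ρ t) δ + Real.exp (-δ * side t / 4) * betaPrime510 d C (δ / 2))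
      atTop (𝓝 0) := by
  have h1 : Tendsto (fun t => betaPrime510 d (ρ t) δ) atTop (𝓝 0) := by
    have := hρ.mul_const (∑' x : Fin d → ℤ, l1 x ^ 2 * Real.exp (-δ * l1 x))
    rw [zero_mul] at this
    simpa only [betaPrime510] using this
  have hcast : Tendsto (fun t => ((side t : ℕ) : ℝ)) atTop atTop := tendsto_natCast_atTop_atTop.comp hside
  have h3 : Tendsto (fun t => -δ * (side t : ℝ) / 4) atTop atBot :=
    (hcast.const_mul_atTop_of_neg (neg_lt_zero.mpr hδ)).atBot_div_const (by norm_num)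
  have h2 : Tendsto (fun t => Real.exp (-δ * (side t : ℝ) / 4)) atTop (𝓝 0) := Real.tendsto_exp_atBot.comp h3
  have := h1.add (h2.mul_const (betaPrime510 d C (δ / 2)))
  simpa using this

/-- Squeezing form: under the hypotheses of `abs_torusSecondMoment_sub_secondMoment_le` with `ρ t → 0` and
`side t → ∞`, `torusSecondMoment (P t) μ ν → B12Beta.secondMoment Pinf μ ν` (the sibling module's conclusion, reached
through the explicit error instead of dominated convergence). [cite: Balaban1987RG1, (1.22) p.264] -/
theorem tendsto_torusSecondMoment_of_volumeRate (hδ : 0 < δ) (hinf : ∀ μ ν, Decay510 (Pinf μ ν) C δ)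
    (hrate : VolumeRate side P Pinf ρ δ) (hρ : Tendsto ρ atTop (𝓝 0)) (hside : Tendsto side atTop atTop)
    (μ ν : Fin d) :
    Tendsto (fun t => torusSecondMoment (P t) μ ν) atTop (𝓝 (B12Beta.secondMoment Pinf μ ν)) := by
  apply tendsto_sub_nhds_zero_iff.mp
  refine squeeze_zero_norm' (Eventually.of_forall fun t => ?_) (tendsto_volumeError (d := d) hδ hρ hside C)
  rw [Real.norm_eq_abs]
  exact abs_torusSecondMoment_sub_secondMoment_le hδ hinf hrate t μ ν

end Error

/-! ## Part 4 — read on pv25's `OneLoopDictionary`: the explicit error for `β⁰_T` and the (AF-0s) list -/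

section Dictionary

variable {d c : ℕ} {β : (k : ℕ) → (Fin (k + 1) → ℝ) → ℝ} {S : B12Beta.OneLoopSplit β}

/-- **Explicit error for row num's observable.**  For a dictionary `D` ((1.21) `isLimit`, (1.22) `beta0_eq`), a scale
`k`, a colour `a`: if the one-loop limit kernel `D.limKernel k` obeys (5.10) with `(C, δ)`, `δ > 0`, and the torus
kernels `torusKernel (D.model k t) a` approach it at the volume rate `ρ` (`VolumeRate`), then for every volume index `t`
and `μ ≠ ν`: `|β⁰_T − S.β0 k| ≤ β′(ρ t, δ) + e^{−δ·side/4}·β′(C, δ/2)`.  Nothing about Bałaban's kernels is asserted;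
regularity (`D.smooth`) and the coordinate convention stay with the instance builder (referee G-beta-7).
[cite: Balaban1987RG1, (1.22) p.264] -/
theorem OneLoopDictionary.abs_torusBetaZero_sub_beta0_le (D : OneLoopDictionary d c S) (k : ℕ) (a : Fin c)
    {C δ : ℝ} {ρ : ℕ → ℝ} (hδ : 0 < δ) (hinf : ∀ μ ν, Decay510 (D.limKernel k μ ν) C δ)
    (hrate : VolumeRate (D.side k) (fun t => torusKernel (D.model k t) a) (D.limKernel k) ρ δ)
    {μ ν : Fin d} (hμν : μ ≠ ν) (t : ℕ) :
    |torusBetaZero (D.model k t) a μ ν - S.β0 k| ≤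
      betaPrime510 d (ρ t) δ + Real.exp (-δ * D.side k t / 4) * betaPrime510 d C (δ / 2) := by
  rw [D.beta0_eq k μ ν hμν]
  exact abs_torusSecondMoment_sub_secondMoment_le hδ hinf hrate t μ ν

/-- Primed form: the (5.10) input for the LIMIT kernel replaced by the sibling module's `UniformDecay` of the TORUS
kernels (then the limit kernel inherits (5.10), `InfiniteVolume.decay510_of_isInfiniteVolumeLimit`, using the
dictionary's own `isLimit`). [cite: Balaban1987RG1, (5.10) p.293] -/
theorem OneLoopDictionary.abs_torusBetaZero_sub_beta0_le' (D : OneLoopDictionary d c S) (k : ℕ) (a : Fin c)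
    (hside : Tendsto (D.side k) atTop atTop) {C δ : ℝ} {ρ : ℕ → ℝ} (hδ : 0 < δ)
    (hdec : UniformDecay (D.side k) (fun t => torusKernel (D.model k t) a) C δ)
    (hrate : VolumeRate (D.side k) (fun t => torusKernel (D.model k t) a) (D.limKernel k) ρ δ)
    {μ ν : Fin d} (hμν : μ ≠ ν) (t : ℕ) :
    |torusBetaZero (D.model k t) a μ ν - S.β0 k| ≤
      betaPrime510 d (ρ t) δ + Real.exp (-δ * D.side k t / 4) * betaPrime510 d C (δ / 2) :=
  D.abs_torusBetaZero_sub_beta0_le k a hδ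
    (fun μ' ν' => decay510_of_isInfiniteVolumeLimit hside (D.isLimit' k a) hdec μ' ν') hrate hμν t

/-- ONE CERTIFIED TORUS VALUE ⇒ A LOWER BOUND FOR THE (1.22) COEFFICIENT: `|β⁰_T − S.β0 k| ≤ e` and `q + e ≤ β⁰_T`
give `q ≤ S.β0 k`.  Pure bookkeeping (the shape in which ONE finite volume reaches (AF-0s); compare the sibling module's
`OneLoopDictionary.le_beta0_of_eventually`, which needs all large volumes). [folklore] -/
theorem OneLoopDictionary.le_beta0_of_certifiedTorus (D : OneLoopDictionary d c S) {k t : ℕ} {a : Fin c}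
    {μ ν : Fin d} {e q : ℝ} (herr : |torusBetaZero (D.model k t) a μ ν - S.β0 k| ≤ e)
    (hcert : q + e ≤ torusBetaZero (D.model k t) a μ ν) : q ≤ S.β0 k := by
  have h := (abs_le.mp herr).2
  linarith

/-- **(AF-0s) FROM CERTIFIED TORUS VALUES.**  The small-`k` hypothesis `hsmall : ∀ k < k₀, 3·β⁰_∞/4 ≤ S.β0 k` of
`FlowStepRuns.thm2Printed_of_limitSplit` / `betaLowerH_of_limitSplit` follows from an error bound `|β⁰_T − S.β0 k| ≤
ε k t` (e.g. `abs_torusBetaZero_sub_beta0_le`) and, for each `k < k₀`, ONE volume `t` at which a certified computation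
gives `3β⁰_∞/4 + ε k t ≤ β⁰_{T_t}`.  The certified inequalities are row num's to supply. [folklore] -/
theorem OneLoopDictionary.beta0_lower_of_certifiedTori (D : OneLoopDictionary d c S) (a : Fin c) (μ ν : Fin d)
    (ε : ℕ → ℕ → ℝ) {binf : ℝ} {k₀ : ℕ}
    (herr : ∀ k t, k < k₀ → |torusBetaZero (D.model k t) a μ ν - S.β0 k| ≤ ε k t)
    (hcert : ∀ k, k < k₀ → ∃ t, 3 * binf / 4 + ε k t ≤ torusBetaZero (D.model k t) a μ ν) :
    ∀ k, k < k₀ → 3 * binf / 4 ≤ S.β0 k := by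
  intro k hk
  obtain ⟨t, ht⟩ := hcert k hk
  exact D.le_beta0_of_certifiedTorus (herr k t hk) ht

/-- **(AF-0s) END-TO-END UNDER THE TYPED HYPOTHESES OF THIS MODULE.**  (5.10) for the one-loop limit kernels at the
scales `k < k₀` (constants `C, δ`, `δ > 0`), volume rates `ρ k` there, and for each such `k` ONE volume `t` with a
certified inequality `3β⁰_∞/4 + (β′(ρ k t, δ) + e^{−δ·side/4}·β′(C, δ/2)) ≤ β⁰_T` give `∀ k < k₀, 3β⁰_∞/4 ≤ S.β0 k`
(`μ ≠ ν`). [cite: Balaban1987RG1, (1.22) p.264] -/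
theorem OneLoopDictionary.hsmall_of_volumeRate (D : OneLoopDictionary d c S) (a : Fin c) {μ ν : Fin d}
    (hμν : μ ≠ ν) {C δ : ℝ} (hδ : 0 < δ) (ρ : ℕ → ℕ → ℝ) {binf : ℝ} {k₀ : ℕ}
    (hinf : ∀ k, k < k₀ → ∀ μ' ν', Decay510 (D.limKernel k μ' ν') C δ)
    (hrate : ∀ k, k < k₀ → VolumeRate (D.side k) (fun t => torusKernel (D.model k t) a) (D.limKernel k) (ρ k) δ)
    (hcert : ∀ k, k < k₀ → ∃ t,
      3 * binf / 4 + (betaPrime510 d (ρ k t) δ + Real.exp (-δ * D.side k t / 4) * betaPrime510 d C (δ / 2)) ≤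
        torusBetaZero (D.model k t) a μ ν) :
    ∀ k, k < k₀ → 3 * binf / 4 ≤ S.β0 k :=
  D.beta0_lower_of_certifiedTori a μ ν
    (fun k t => betaPrime510 d (ρ k t) δ + Real.exp (-δ * D.side k t / 4) * betaPrime510 d C (δ / 2))
    (fun k t hk => D.abs_torusBetaZero_sub_beta0_le k a hδ (hinf k hk) (hrate k hk) hμν t) hcert

end Dictionary

end Literature.MathematicalPhysics.QuantumFieldTheory.Balaban1983to89.Beta
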